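import Summits.HodgeConjecture.HodgeConjecture.Theses.NikulinTwinTransport

/-!
# Crux `NikulinSerreCarrier` (stmt-HodgeConjecture-14464), line `modular-twin-address`:
# certified cores of the ADDRESS CONSTRAINTS (second line lead, cycle 1)

Sorry-free linear-algebra / arithmetic shells of the necessary conditions on the address
`g : Y′ ↪ Mv` of `stub_modularTwinAddress` derived in the crux work-file
`Cruxes/NikulinSerreCarrier/AddressConstraints-modular-twin-address.md` (evidence
`20260816T060844Z-ADDRESS-CONSTRAINTS.md`):

* `isCompl_of_bijective_restrict` — (S1): if a linear map `g : V → U` restricts to a bijection on a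
  subspace `W`, then `V = W ⊕ ker g` (applied to `W = θ(H²(X,ℚ))`, `g = g^*`: `H²(Mv,ℚ) = θ(H²X) ⊕ ker g^*`);
* `kaehlerClass_pinned` — (S2): `g κ = ω′`, `g θω = (−2m)•ω′` and `κ + (2m)⁻¹•θω ∈ P` with `P ∩ ker g = 0`
  force `κ = −(2m)⁻¹•θω` (the Kähler class of `Mv` is pinned to the ray of `θ(ω)`, i.e. to J. Li's
  determinant class in the modular realisation — the Uhlenbeck-wall condition, CONCLUSION A);
* `one_lt_gram_ratio` — (S4): in a negative definite plane, `q(δ′)q(ν)/q(δ′,ν)² > 1` unless `δ′ ∥ ν`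
  (the frame parameter `t ≥ 1`, with `t = 1` exactly in a generic frame);
* `noether_iff_conic`, `conic_generic_frame`, `no_rat_generic_frame` — §3 (the K3^[2]-type sector):
  the Noether identity `⟨[Z],c₂⟩ − [Z]² = 24` with `⟨[Z],c₂⟩ = (6μ/5)(21+t)` and
  `[Z]² = (μ²/4)(42 + 2t² − (2/25)(21+t)²)` is the conic `4s² − (7μ+10)s + 14μ² − 210μ + 200 = 0`
  (`s = μt`), which at `t = 1` reads `11μ² − 220μ + 200 = 0` and has NO rational solution
  (`(11μ − 110)² = 9900 = 30²·11`).

Nothing here asserts a Theses declaration; the geometric inputs (Verbitsky 1995 Thm 4.1, Verbitsky 1998 §5,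
Huybrechts–Lehn Thm 8.2.8, the Fujiki constants of K3^[2]) are recorded in the work-file, not assumed here.
-/

namespace Summit.HodgeConjecture.HodgeConjecture.Theorems.NikulinTwinTransport.AddressCores

/-! ## (S1) The kernel of the restriction is a complement of `θ(H²X)` -/

section Kernel

variable {K : Type*} [Field K] {V U : Type*} [AddCommGroup V] [Module K V] [AddCommGroup U] [Module K U]

/-- **(S1).** If `g : V →ₗ U` restricts to a bijection `W → U` on a subspace `W`, then `W` and `ker g` are
complementary: `V = W ⊕ ker g`.  (For the address: `g = g^*` on `H²(Mv,ℚ)`, `W = θ(H²(X,ℚ))`, on which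
`g^* = −mΨᵗ∘θ⁻¹` is bijective onto `H²(Y′,ℚ)`.) [folklore] -/
theorem isCompl_of_bijective_restrict (g : V →ₗ[K] U) (W : Submodule K V)
    (h : Function.Bijective (g.comp W.subtype)) : IsCompl W (LinearMap.ker g) := by
  let e : W ≃ₗ[K] U := LinearEquiv.ofBijective (g.comp W.subtype) h
  have he : ∀ w : W, e w = g w := fun w ↦ rfl
  refine IsCompl.of_eq ?_ ?_
  · rw [Submodule.eq_bot_iff]
    intro v hv
    obtain ⟨hvW, hvk⟩ := Submodule.mem_inf.1 hv
    have h1 : e ⟨v, hvW⟩ = 0 := by rw [he]; exact hvk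
    have h2 : (⟨v, hvW⟩ : W) = 0 := e.injective (by rw [h1, map_zero])
    exact congrArg Subtype.val h2
  · rw [Submodule.eq_top_iff']
    intro v
    have hsplit : v = (e.symm (g v) : V) + (v - (e.symm (g v) : V)) := by abel
    rw [hsplit]
    refine Submodule.add_mem_sup (e.symm (g v)).2 ?_
    rw [LinearMap.mem_ker, map_sub, ← he, LinearEquiv.apply_symm_apply, sub_self]

end Kernel

/-! ## (S2) The Kähler class is pinned to the ray of `θ(ω)` -/

section Pinned

/-- **(S2).** Frame condition `g κ = ω′`, address equation `g (θω) = (−2m)•ω′`, and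
`κ + (2m)⁻¹•θω ∈ P` for a subspace `P` meeting `ker g` trivially (the `V₃`-isotypic 3-plane of Kähler
classes contains no `SU(2)`-invariant vector, while `ker g^*` consists of invariants) force
`κ = −(2m)⁻¹ • θω`. [folklore] -/
theorem kaehlerClass_pinned :
    ∀ {K : Type*} [Field K] {V U : Type*} [AddCommGroup V] [Module K V] [AddCommGroup U] [Module K U] (g : V →ₗ[K] U) (P : Submodule K V), (∀ v ∈ P, g v = 0 → v = 0) → ∀ {κ θω : V} {ω' : U} {m : K}, (2 : K) * m ≠ 0 → g κ = ω' → g θω = (-(2 * m)) • ω' → κ + (2 * m)⁻¹ • θω ∈ P → κ = -((2 * m)⁻¹ • θω) := by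
  intro K _ V U _ _ _ _ g P hP κ θω ω' m h2m hκ hθ hmem
  have h0 : g (κ + (2 * m)⁻¹ • θω) = 0 := by
    have hc : (2 * m)⁻¹ * (-(2 * m)) = -1 := by rw [mul_neg, inv_mul_cancel₀ h2m]
    rw [map_add, map_smul, hκ, hθ, smul_smul, hc, neg_one_smul, add_neg_cancel]
  have h1 := hP _ hmem h0
  exact eq_neg_of_add_eq_zero_left h1

end Pinned

/-! ## (S4) The frame parameter `t ≥ 1` -/

section Gram

/-- **(S4).** If the binary form `d x² + 2p xy + e y²` is negative definite and `p ≠ 0`, then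
`d e > p²`, i.e. the ratio `t = q(δ′)q(ν)/q(δ′,ν)²` of a negative definite plane exceeds `1`
(and equals `1` only in the degenerate case `δ′ ∥ ν`, excluded here by definiteness). [folklore] -/
theorem one_lt_gram_ratio (d e p : ℝ) (hp : p ≠ 0)
    (hneg : ∀ x y : ℝ, (x ≠ 0 ∨ y ≠ 0) → d * x ^ 2 + 2 * p * x * y + e * y ^ 2 < 0) :
    1 < d * e / p ^ 2 := by
  have hd : d < 0 := by
    have := hneg 1 0 (Or.inl one_ne_zero)
    simpa using this
  have h1 := hneg p (-d) (Or.inl hp)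
  have h2 : d * (e * d - p ^ 2) < 0 := by nlinarith
  have h3 : 0 < e * d - p ^ 2 := by
    rcases lt_or_ge 0 (e * d - p ^ 2) with h | h
    · exact h
    · have : 0 ≤ d * (e * d - p ^ 2) := mul_nonneg_of_nonpos_of_nonpos hd.le h
      linarith
  have hp2 : 0 < p ^ 2 := by positivity
  rw [lt_div_iff₀ hp2]
  nlinarith

end Gram

/-! ## §3 The K3^[2]-type sector: Noether's identity is a conic, empty in a generic frame -/

section Fourfold

/-- **Noether ⟺ conic.**  With `⟨[Z],c₂⟩ = (6μ/5)(21+t)` and `[Z]² = (μ²/4)(42 + 2t² − (2/25)(21+t)²)`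
(K3^[2]-type Fujiki bookkeeping, work-file §3), the identity `⟨[Z],c₂⟩ − [Z]² = 24` is equivalent to
`4s² − (7μ+10)s + 14μ² − 210μ + 200 = 0` for `s = μt`. [folklore] -/
theorem noether_iff_conic (μ t : ℝ) :
    6 * μ / 5 * (21 + t) - μ ^ 2 / 4 * (42 + 2 * t ^ 2 - 2 / 25 * (21 + t) ^ 2) = 24 ↔
      4 * (μ * t) ^ 2 - (7 * μ + 10) * (μ * t) + 14 * μ ^ 2 - 210 * μ + 200 = 0 := by
  constructor
  · intro h
    linear_combination (-(25 : ℝ) / 3) * h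
  · intro h
    linear_combination (-(3 : ℝ) / 25) * h

/-- **Generic frame (`t = 1`).**  The conic specialises to `11μ² − 220μ + 200 = 0`. [folklore] -/
theorem conic_generic_frame (μ : ℝ) :
    4 * (μ * 1) ^ 2 - (7 * μ + 10) * (μ * 1) + 14 * μ ^ 2 - 210 * μ + 200 =
      11 * μ ^ 2 - 220 * μ + 200 := by
  ring

/-- **No rational solution in a generic frame.**  `11μ² − 220μ + 200 = 0` has no rational root:
`(11μ − 110)² = 9900 = 30²·11` would make `11` a rational square. So no K3^[2]-type address of the twin
exists in a generic frame (work-file §3; the geometric inputs are recorded there). [folklore] -/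
theorem no_rat_generic_frame : ∀ μ : ℚ, 11 * μ ^ 2 - 220 * μ + 200 ≠ 0 := by
  intro μ h
  have hsq : ((11 * μ - 110) / 30) ^ 2 = 11 := by
    field_simp
    linear_combination (11 : ℚ) * h
  have hirr : Irrational (Real.sqrt 11) := Nat.Prime.irrational_sqrt (by norm_num)
  apply hirr.ne_rat |(11 * μ - 110) / 30|
  have hcast : ((11 : ℚ) : ℝ) = (((11 * μ - 110) / 30) ^ 2 : ℚ) := by rw [hsq]
  rw [show (11 : ℝ) = ((11 : ℚ) : ℝ) by norm_num, hcast]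
  push_cast
  rw [Real.sqrt_sq_eq_abs]

/-- Hence the Noether identity with the generic-frame bookkeeping (`t = 1`) fails for every rational
multiplier `μ`. [folklore] -/
theorem noether_generic_frame_false (μ : ℚ) :
    6 * (μ : ℝ) / 5 * (21 + 1) - (μ : ℝ) ^ 2 / 4 * (42 + 2 * 1 ^ 2 - 2 / 25 * (21 + 1) ^ 2) ≠ 24 := by
  intro h
  have h1 := (noether_iff_conic (μ : ℝ) 1).1 h
  rw [conic_generic_frame] at h1
  apply no_rat_generic_frame μ
  exact_mod_cast h1

end Fourfold

end Summit.HodgeConjecture.HodgeConjecture.Theorems.NikulinTwinTransport.AddressCores
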